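import Summits.BirchSwinnertonDyer.BirchSwinnertonDyer.Theses.PrintX8VSC
import Summits.BirchSwinnertonDyer.BirchSwinnertonDyer.Theorems.PrintX8VSCRankOneLinkOfPrintX8ContraOfCorA5
import HarnessLib

/-!
# Route `PrintX8VSC` (rev 4), item stmt-BirchSwinnertonDyer-23773 `RankOneLinkOfPrintX8ContraOfBKO`
# (child 2 of the glued split of 23745 `RankOneLinkOfPrintX8Contra`) — CLOSED BY NAME from the landed helper
# `PrintX8VSCGlue.rankOneLinkOfPrintX8Contra_of_corA5Contra` (p675813, `Theorems/PrintX8VSCRankOneLinkOfPrintX8ContraOfCorA5.lean`)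

TURNKEY closer prepared by the x8 planner (bsd-print-x8-plan g34; planners never propose Theorems — a PROVER seat files this with
`ledger propose --kind proof --target Summits/BirchSwinnertonDyer/BirchSwinnertonDyer/Theorems/PrintX8VSCRankOneLinkOfPrintX8ContraOfBKO.lean
--file <this> --workitem stmt-BirchSwinnertonDyer-23773`). HONEST FRAMING: plumbing. The statement is
`InputBKOCorA5SharpFlatContra → RankOneLinkOfPrintX8Contra`: GIVEN the print-keyed ♯/♭ reading of Burungale–Kobayashi–Ota App. A
Cor. A.5 (`BurungaleKobayashiOta2024.corA5_pPart_of_sharpFlatCharIdeal_eq_contra`, a statement-only Literature fact, INPUTS τ8 p673242)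
as a hypothesis, the route's rank-one link node follows — and that implication is EXACTLY the landed helper of the bsd-ssimc width seat
w3 g10 (ref R-293 PASS, lit T76 concur). Cor. A.5, the main conjecture, leaf X8 and BSD are NOT proved here; PARTITION 0.

References: route file `Theses/PrintX8VSC.lean` (rev 4, items 23745 / 23772 / 23773 / 23779); [BurungaleKobayashiOta2023] App. A Cor. A.5;
[Sprung2012] Prop. 7.19, Main Conj. 7.21 (p. 1505); [Sprung2017] Thm. 1.12; [Kobayashi2013] Cor. 1.3 (iii).
-/

set_option autoImplicit false
-- justification: the mandated namespace `Summit.BirchSwinnertonDyer.BirchSwinnertonDyer.Theorems`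
-- (single-conjunct summit, Sub = Summit) repeats a segment by design (D-0017).
set_option linter.dupNamespace false

namespace Summit.BirchSwinnertonDyer.BirchSwinnertonDyer.Theorems.PrintX8VSCGlue

open Summit.BirchSwinnertonDyer.BirchSwinnertonDyer.Theses.PrintX8VSC

/-- **Item stmt-BirchSwinnertonDyer-23773 `PrintX8VSC.RankOneLinkOfPrintX8ContraOfBKO` holds**: the held print-keyed BKO Cor. A.5
fact ⟹ (published bundle → GZK → print-keyed ♯/♭ main conjecture on X8 at analytic rank `≤ 1` → `Typed.MissingPPartAt W p` at every
X8 pair of analytic rank `1`) — by name from `rankOneLinkOfPrintX8Contra_of_corA5Contra` (p675813). Unconditional as an implication;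
closes this item only. [cite: BurungaleKobayashiOta2023, App. A Cor. A.5] [cite: Sprung2012, Prop. 7.19 and Main Conj. 7.21 (p. 1505)]
[cite: Sprung2017, Thm. 1.12] -/
theorem rankOneLinkOfPrintX8ContraOfBKO_holds : RankOneLinkOfPrintX8ContraOfBKO := fun hBKO =>
  rankOneLinkOfPrintX8Contra_of_corA5Contra hBKO

end Summit.BirchSwinnertonDyer.BirchSwinnertonDyer.Theorems.PrintX8VSCGlue
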